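import Literature.Geometry.GeometricMeasureTheory.ApproxTangentLipschitz
import Literature.Analysis.Calculus.PreimageNullCritical
import Literature.Analysis.Calculus.LipschitzSardHausdorff
import Mathlib.Analysis.Calculus.Rademacher
import Mathlib.Analysis.InnerProductSpace.PiL2
import HarnessLib

/-!
# A linear map is a.e. degenerate on the approximate tangent planes over a null set of values

Support file for the proof of Federer's support theorem for integral flat chains
(`Literature.Geometry.GeometricMeasureTheory.Federer1969_support_integralFlatChain`); proved
from Mathlib, `Currents.lean` and the three support files
`ApproxTangentLipschitz.lean` (tangent vectors of Lipschitz parametrisations are approximate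
tangent vectors, Federer 3.2.19), `Literature/Analysis/Calculus/LipschitzSardHausdorff.lean`
(`𝓗ʲ(g{Dg singular}) = 0`, Federer 3.2.3) and `Literature/Analysis/Calculus/PreimageNullCritical.lean`
(on the preimage of a null set the differential is a.e. not onto, Federer 3.2.22). No named facts,
no definitions.

**Theorem** (`ae_map_span_frame_ne_top`). Let `W ⊆ V` be a measurable, countably
`j`-rectifiable subset of a finite-dimensional real normed space, `μ = 𝓗ʲ ⌞ W` (Euclidean
normalisation `μHE`), and `ξ : V → (Fin j → V)` a frame field whose span is, `μ`-a.e., the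
approximate tangent cone `Tan^j(μ, x)` of `Currents.lean`. Let `P : V → F` be a continuous linear
map to a finite-dimensional space with Haar measure `ν` and `B ⊆ F` a `ν`-null set. Then for
`μ`-a.e. `x ∈ P⁻¹(B)` the linear map `P` does NOT map the tangent plane `span ξ(x)` onto `F`.

For `dim F = j` this says `det (P ∘ ξ(x)) = 0`, and for `dim F = j - 1` that all maximal minors
of `P ∘ ξ(x)` vanish, `μ`-a.e. on `W ∩ P⁻¹(B)`: the qualitative content of the area and co-area
formulae on rectifiable sets (Federer 3.2.20, 3.2.22), which replaces 4.1.18 in the proof of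
the support theorem 4.1.20 for the integral flat chains of `Currents.lean`.

## The proof

Cover `W`, up to a `μ`-null set, by Lipschitz images `gᵢ(ℝʲ)` (reparametrising the Euclidean
parametrisations of `IsCountablyRectifiable` by `ℝʲ = Fin j → ℝ`). For each `i`, the parameters
`u` at which `gᵢ` is not differentiable (Rademacher), or the tangent-cone inclusion of 3.2.19
fails, or `D(P ∘ gᵢ)(u)` is onto although `P (gᵢ u) ∈ B`, form a Lebesgue-null set, whose image is
`𝓗ʲ`-null; so is the image of the singular set `{Dgᵢ(u) not injective}`. At every other parameter
`u` over `x = gᵢ u ∈ W ∩ P⁻¹ B` with `span ξ(x) = Tan^j(μ, x)`: `im Dgᵢ(u) ⊆ Tan^j(μ, x) = span ξ(x)`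
with equality by dimension, and `P(span ξ(x)) = im D(P ∘ gᵢ)(u) ≠ F`.

## References

* H. Federer, *Geometric Measure Theory*, Springer 1969, 3.2.19, 3.2.22 (and 2.10.19, 3.2.16).
-/

noncomputable section

open MeasureTheory MeasureTheory.Measure Set Function Filter Metric Module
open scoped ENNReal NNReal Topology

namespace Literature.Geometry.GeometricMeasureTheory

variable {V : Type*} [NormedAddCommGroup V] [NormedSpace ℝ V] [MeasurableSpace V] [BorelSpace V]

omit [NormedSpace ℝ V] [BorelSpace V] in
/-- The upper density scales with the measure: `Θ*ᵐ(c μ, a) = c Θ*ᵐ(μ, a)` for `c < ∞`.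
[cite: Federer1969, 2.10.19] -/
theorem upperDensity_smul (m : ℕ) (μ : Measure V) (a : V) {c : ℝ≥0∞} (hc : c ≠ ⊤) :
    upperDensity m (c • μ) a = c * upperDensity m μ a := by
  unfold upperDensity
  rw [← ENNReal.limsup_const_mul_of_ne_top hc]
  congr 1
  funext r
  rw [Measure.smul_apply, smul_eq_mul, mul_div_assoc]

variable [FiniteDimensional ℝ V] {F : Type*} [NormedAddCommGroup F] [NormedSpace ℝ F]
  [FiniteDimensional ℝ F] [MeasurableSpace F] [BorelSpace F]

/-- **A linear map is a.e. degenerate on the approximate tangent planes over a null set of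
values** (qualitative area/co-area formula on a rectifiable set). Let `W ⊆ V` be measurable and
countably `j`-rectifiable, `μ = 𝓗ʲ ⌞ W` (`μHE`), `ξ` a `j`-frame field with `span ξ(x) = Tan^j(μ, x)`
for `μ`-a.e. `x`, `P : V →L F` linear, `ν` a Haar measure on `F` and `ν(B) = 0`. Then for `μ`-a.e.
`x` with `P x ∈ B`, `P (span ξ(x)) ≠ F`. [cite: Federer1969, 3.2.22 (with 3.2.19, 3.2.3)] -/
theorem ae_map_span_frame_ne_top {j : ℕ} {W : Set V} (hWm : MeasurableSet W)
    (hWr : IsCountablyRectifiable j W) {ξ : V → Fin j → V}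
    (hξ : ∀ᵐ x ∂((μHE[j] : Measure V).restrict W),
      ((Submodule.span ℝ (range (ξ x)) : Set V) =
        approxTangentCone j ((μHE[j] : Measure V).restrict W) x))
    (P : V →L[ℝ] F) (ν : Measure F) [IsAddHaarMeasure ν] {B : Set F} (hB : ν B = 0) :
    ∀ᵐ x ∂((μHE[j] : Measure V).restrict W), P x ∈ B →
      Submodule.map (P : V →ₗ[ℝ] F) (Submodule.span ℝ (range (ξ x))) ≠ ⊤ := by
  classical
  set μ : Measure V := (μHE[j] : Measure V).restrict W with hμ
  -- the normalisation constant `μHE[j] = c • μH[j]`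
  set c : ℝ≥0∞ := (addHaarScalarFactor (volume : Measure (EuclideanSpace ℝ (Fin j)))
    (μH[j] : Measure (EuclideanSpace ℝ (Fin j))) : ℝ≥0∞) with hc_def
  have hc0 : c ≠ 0 := by
    rw [hc_def, Ne, ENNReal.coe_eq_zero]
    exact Measure.addHaarScalarFactor_volume_hausdorffMeasure_ne_zero j
  have hctop : c ≠ ⊤ := ENNReal.coe_ne_top
  have hHE : (μHE[j] : Measure V) = c • (μH[j] : Measure V) := by
    rw [Measure.euclideanHausdorffMeasure_def, hc_def, ENNReal.smul_def]
  have hHE0 : ∀ s : Set V, (μH[j] : Measure V) s = 0 → μ s = 0 := by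
    intro s hs
    rw [hμ]
    refine measure_mono_null (le_refl s) ?_
    refine nonpos_iff_eq_zero.1 ((Measure.le_iff'.1 Measure.restrict_le_self s).trans ?_)
    rw [hHE, Measure.smul_apply, hs, smul_zero]
  -- Lipschitz parametrisations by `ℝʲ = Fin j → ℝ`
  obtain ⟨f, hf, hcov⟩ := hWr
  let e := EuclideanSpace.equiv (Fin j) ℝ
  let g : ℕ → (Fin j → ℝ) → V := fun i => f i ∘ e.symm
  have hg : ∀ i, ∃ L : ℝ≥0, LipschitzWith L (g i) := fun i => by
    obtain ⟨K, hK⟩ := hf i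
    exact ⟨_, hK.comp (e.symm : (Fin j → ℝ) →L[ℝ] EuclideanSpace ℝ (Fin j)).lipschitz⟩
  have hrange : ∀ i, range (g i) = range (f i) := fun i => by
    ext x
    constructor
    · rintro ⟨u, rfl⟩
      exact ⟨e.symm u, rfl⟩
    · rintro ⟨y, rfl⟩
      exact ⟨e y, by simp [g]⟩
  have hcovμ : ∀ᵐ x ∂μ, x ∈ ⋃ i, range (g i) := by
    have h1 : μ (⋃ i, range (g i))ᶜ = 0 := by
      rw [hμ, Measure.restrict_apply' hWm]
      have : (⋃ i, range (g i))ᶜ ∩ W = W \ ⋃ i, range (f i) := by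
        rw [sdiff_eq, inter_comm, iUnion_congr hrange]
      rw [this]
      exact hcov
    filter_upwards [measure_eq_zero_iff_ae_notMem.1 h1] with x hx
    simpa using hx
  have hWμ : ∀ᵐ x ∂μ, x ∈ W := ae_restrict_mem hWm
  -- reduction to one parametrisation
  suffices H : ∀ i, ∀ᵐ x ∂μ, x ∈ range (g i) → x ∈ W →
      ((Submodule.span ℝ (range (ξ x)) : Set V) = approxTangentCone j μ x) →
      P x ∈ B → Submodule.map (P : V →ₗ[ℝ] F) (Submodule.span ℝ (range (ξ x))) ≠ ⊤ by
    have H' := ae_all_iff.2 H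
    filter_upwards [H', hcovμ, hWμ, hξ] with x hx hxU hxW hxξ hPB
    obtain ⟨i, hi⟩ := mem_iUnion.1 hxU
    exact hx i hi hxW hxξ hPB
  intro i
  obtain ⟨L, hL⟩ := hg i
  have hjc : Fintype.card (Fin j) = j := Fintype.card_fin j
  -- `μH[j] = volume` on `ℝʲ`
  have hvol : (μH[j] : Measure (Fin j → ℝ)) = volume := by
    have := hausdorffMeasure_pi_real (ι := Fin j)
    rwa [hjc] at this
  -- the three Lebesgue-null exceptional parameter sets
  have h1 : ∀ᵐ u ∂(volume : Measure (Fin j → ℝ)), DifferentiableAt ℝ (g i) u :=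
    hL.ae_differentiableAt
  have h2 : ∀ᵐ u ∂(volume : Measure (Fin j → ℝ)), g i u ∈ W → DifferentiableAt ℝ (g i) u →
      Injective (fderiv ℝ (g i) u) → ∀ S : Set V,
        upperDensity j (((μH[j] : Measure V).restrict W).restrict Sᶜ) (g i u) = 0 →
        ∀ v, fderiv ℝ (g i) u v ∈ posTangentConeAt S (g i u) := by
    have := fderiv_apply_mem_posTangentConeAt_ae hL hWm
    rwa [hjc] at this
  have h3 : ∀ᵐ u ∂(volume : Measure (Fin j → ℝ)), (P ∘ g i) u ∈ B →
      DifferentiableAt ℝ (P ∘ g i) u → ¬ Surjective (fderiv ℝ (P ∘ g i) u) :=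
    Literature.Analysis.Calculus.ae_not_surjective_fderiv_of_mapsTo_null ν
      (P.continuous.comp hL.continuous) hB
  -- their union `E` and the singular set `Z` have `μH[j]`-null images
  set E : Set (Fin j → ℝ) := {u | ¬ (DifferentiableAt ℝ (g i) u ∧
      (g i u ∈ W → DifferentiableAt ℝ (g i) u → Injective (fderiv ℝ (g i) u) → ∀ S : Set V,
        upperDensity j (((μH[j] : Measure V).restrict W).restrict Sᶜ) (g i u) = 0 →
        ∀ v, fderiv ℝ (g i) u v ∈ posTangentConeAt S (g i u)) ∧
      ((P ∘ g i) u ∈ B → DifferentiableAt ℝ (P ∘ g i) u →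
        ¬ Surjective (fderiv ℝ (P ∘ g i) u)))} with hE
  have hE0 : volume E = 0 := by
    have : ∀ᵐ u ∂(volume : Measure (Fin j → ℝ)), DifferentiableAt ℝ (g i) u ∧
        (g i u ∈ W → DifferentiableAt ℝ (g i) u → Injective (fderiv ℝ (g i) u) → ∀ S : Set V,
          upperDensity j (((μH[j] : Measure V).restrict W).restrict Sᶜ) (g i u) = 0 →
          ∀ v, fderiv ℝ (g i) u v ∈ posTangentConeAt S (g i u)) ∧
        ((P ∘ g i) u ∈ B → DifferentiableAt ℝ (P ∘ g i) u →
          ¬ Surjective (fderiv ℝ (P ∘ g i) u)) := by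
      filter_upwards [h1, h2, h3] with u h1 h2 h3 using ⟨h1, h2, h3⟩
    exact ae_iff.1 this
  set Z : Set (Fin j → ℝ) := {u | DifferentiableAt ℝ (g i) u ∧ ¬ Injective (fderiv ℝ (g i) u)}
    with hZ
  have hZ0 : (μH[j] : Measure V) (g i '' Z) = 0 := by
    have := Literature.Analysis.Calculus.hausdorffMeasure_image_null_of_fderiv_not_injective hL
    rwa [hjc] at this
  have hE0' : (μH[j] : Measure V) (g i '' E) = 0 := by
    refine nonpos_iff_eq_zero.1 ((hL.hausdorffMeasure_image_le (Nat.cast_nonneg j) E).trans ?_)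
    rw [hvol, hE0, mul_zero]
  have hbad : ∀ᵐ x ∂μ, x ∉ g i '' (E ∪ Z) := by
    refine measure_eq_zero_iff_ae_notMem.1 (hHE0 _ ?_)
    rw [image_union]
    exact measure_union_null hE0' hZ0
  -- the pointwise argument
  filter_upwards [hbad] with x hx hxr hxW hxξ hPB
  obtain ⟨u, rfl⟩ := hxr
  have huE : u ∉ E := fun h => hx (mem_image_of_mem _ (Or.inl h))
  have huZ : u ∉ Z := fun h => hx (mem_image_of_mem _ (Or.inr h))
  simp only [hE, mem_setOf_eq, not_not] at huE
  obtain ⟨hdiff, hT, hC⟩ := huE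
  have hinj : Injective (fderiv ℝ (g i) u) := by
    by_contra h
    exact huZ ⟨hdiff, h⟩
  set T := fderiv ℝ (g i) u with hT_def
  -- `im Dg(u) ⊆ Tan^j(μ, x) = span ξ(x)`
  have hsub : LinearMap.range (T : (Fin j → ℝ) →ₗ[ℝ] V) ≤ Submodule.span ℝ (range (ξ (g i u))) := by
    rintro _ ⟨v, rfl⟩
    change T v ∈ Submodule.span ℝ (range (ξ (g i u)))
    rw [← SetLike.mem_coe, hxξ]
    refine mem_iInter₂.2 fun S hS => hT hxW hdiff hinj S ?_ v
    -- the upper densities for `μ` and for `μH[j] ⌞ W` vanish together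
    have e1 : μ.restrict Sᶜ = c • (((μH[j] : Measure V).restrict W).restrict Sᶜ) := by
      rw [hμ, hHE, Measure.restrict_smul, Measure.restrict_smul]
    rw [e1, upperDensity_smul _ _ _ hctop, mul_eq_zero] at hS
    exact hS.resolve_left hc0
  -- equality by dimension
  have heq : LinearMap.range (T : (Fin j → ℝ) →ₗ[ℝ] V) = Submodule.span ℝ (range (ξ (g i u))) := by
    refine Submodule.eq_of_le_of_finrank_le hsub ?_
    rw [LinearMap.finrank_range_of_inj hinj, finrank_fin_fun]
    have := finrank_range_le_card (R := ℝ) (ξ (g i u))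
    rw [hjc] at this
    exact this
  -- `P (span ξ(x)) = im D(P ∘ g)(u) ≠ F`
  have hPg : DifferentiableAt ℝ (P ∘ g i) u := P.differentiableAt.comp u hdiff
  have hfd : fderiv ℝ (P ∘ g i) u = P.comp T := (P.hasFDerivAt.comp u hdiff.hasFDerivAt).fderiv
  have hns := hC hPB hPg
  rw [hfd] at hns
  rw [← heq, ← LinearMap.range_comp, Ne, LinearMap.range_eq_top]
  exact hns

end Literature.Geometry.GeometricMeasureTheory
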